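/-
Copyright: the b2b-balaban T⁴-continuum CRUX team, row NE7b OWNER lineage `t4-ne7b-p1` (gen 141). Project licence.
-/
import Summits.QuantumFields.BalabanUV.T4Continuum.Spine.NE7b.SupWhitenedThirdKernelEntry
import Summits.QuantumFields.BalabanUV.T4Continuum.Spine.NE7b.SupKernelClassThirdLetters
import Summits.QuantumFields.BalabanUV.T4Continuum.Spine.NE7b.SupKernelSchurTrilinear

/-!
# THE THIRD-ORDER BLOCK OF THE KERNEL-LETTER CLASS MAP, GENERAL `Γ = AAᵀ` (SCOPING (d13)(1), seventh file).  The INPUT format of the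
# third-order letters ((469)∕(470)∕(473)∕(472)) is: an entrywise majorant `|U‴(φ)[e_v,e_x,e_y]| ≤ K3_{xyv}` for ALL `φ` with the three
# fixed-slot letters `k3r, k3c, k3m`, the row letter `κ₃r` of `U‴` itself and the operator letter `‖U‴‖ ≤ κ₃`.  THE OUTPUT `T = D³W`
# SATISFIES THE SAME FORMAT with `K3⁺_{xyv} := M_{vxy}` ((479)'s background-free majorant):
#   ENTRY      `|T(ψ)[e_v,e_x,e_y]| ≤ K3⁺_{xyv}`  for every `ψ`                                   ((479));
#   LETTERS    `k3r⁺, k3c⁺, k3m⁺`                                                                    ((482), plain letters `dr = dθ`, `dc = dθ′`);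
#   ROW        `Σ_yΣ_z|T(ψ)[e_x,e_y,e_z]| ≤ R₁ = k3c⁺`'s bound                                        (here, §1);
#   OPERATOR   `‖T(ψ)‖ ≤ √(R₂R₃)`  (`R₂, R₃` the bounds of `k3r⁺, k3m⁺`)                               (here, §2: (481)'s Schur at order 3)
# — so at order 3 the kernel-letter class REPRODUCES ITSELF under the fluctuation step with a GENERAL singular finite-range `Γ = AAᵀ`,
# uniformly in the background and the volume, under pure smallness; (426)'s Brascamp–Lieb operator letter (stated for `M ≻ 0`) is superseded
# by Schur (row NE7b, node U5c; (479), (481), (482), (453) `rowsum_le_weighted` BY NAME; [folklore])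

Cell `pub-balaban`, sub-cell `t4`, spine estimate NE7b (`T4WeightBudget.RelWeightBound`; the cell's OWN estimate — NOT PRINTED in
[Bałaban 1983–89], NOT PROVED).  Crux-route work under `Spine/NE7b/` by the row OWNER (`t4-ne7b-p1` gen 141, file (483)) under FREEZE
(0)'s crux-prover clause; NOTHING of Bałaban's is named as a Lean object, valued or asserted; no `T4Continuum/Support` leaf typed; no
`def`, no notation (`T(ψ)`, `K3⁺` WRITTEN OUT); zero `sorry`.  Imports (BY NAME): the OWNER's (479) `…SupWhitenedThirdKernelEntry`
(`whitened_third_kernel_entry`), (482) `…SupKernelClassThirdLetters` (`output_k3c`, `output_k3r`, `output_k3m`), (481) `…SupKernelSchurTrilinear`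
(`opNorm_le_of_slot_letters`).

WHAT IS PROVED ([folklore]; weighted letters of `D` against `θ ≥ 1`, whence the plain ones):
* §1 `plain_row_of_weighted`, `plain_col_of_weighted`; **`output_third_entry_format`** (the entry format with `K3⁺`), **`output_third_rowsum`**.
* §2 THE END **`output_third_opNorm`** (`‖T(ψ)‖ ≤ √(R₂R₃)`); §3 toy.

HONEST (what this is NOT).  The third-order block only: the order-2 block ((459)'s entry majorant `Hk⁺` and its letters `hr⁺ = hr + br·bc·dd′∕c`,
`hc⁺` likewise, `κr⁺`, and `κ₂⁺` by (433)'s Schur) and the one-point letters of (427) (stated there for `M ≻ 0`; the secant∕floor letters for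
a general `Γ` via (464)∕(465)) are NOT repackaged here; the constants GROW per step before rescaling ((433)'s transport, (436)'s ball — the
flow is NOT claimed); `D`, its weighted letters, the weights and the site letter are hypotheses ((453)∕(462) Neumann, (476) finite range);
orders four and five NOT typed; scalar skeleton ((A3), NC-NE7b-α UNRULED); nothing of Bałaban's asserted.  BY-NAME EFFECT ON THE WALL:
NONE.  NE7b NOT PRINTED ∕ NOT PROVED; spine PROVED 0∕9; rung (B)+1 — the programme's measures remain FINITE-torus statements; NOT the mass
gap, NOT Clay.  HONEST DEPENDENCY: continuum YM on T⁴ ⇐ BetaPertH ∧ nine spine estimates (0∕9 proved); BetaPertH ⇐ (D1) ∧ (D4) ∧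
CAP+tail; G-an2-4 gates asym, D1 and NE2∕3∕4.
-/

set_option autoImplicit false
set_option maxSynthPendingDepth 3

noncomputable section

namespace Summit.QuantumFields.BalabanUV.T4Continuum.NE7b.SupKernelClassThirdOrder

open MeasureTheory ProbabilityTheory Finset Real Matrix
open scoped BigOperators Matrix
open SupWhitenedThirdKernelEntry (whitened_third_kernel_entry)
open SupKernelClassThirdLetters (output_k3c output_k3r output_k3m)
open SupKernelSchurTrilinear (opNorm_le_of_slot_letters)

variable {ι κ : Type} [Fintype ι] [DecidableEq ι] [Fintype κ] [DecidableEq κ]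

/-! ## §1. Plain letters from weighted ones; the entry format; the row letter -/

section Plain

variable {D θ : κ → κ → ℝ} {dθ dθ' : ℝ}

omit [Fintype ι] [DecidableEq ι] [DecidableEq κ] in
/-- `Σ_wD_{zw} ≤ Σ_wD_{zw}θ_{zw} ≤ dθ` for `D ≥ 0`, `θ ≥ 1` ((453)'s pattern). [folklore] -/
theorem plain_row_of_weighted (hD : ∀ x y, 0 ≤ D x y) (hθw1 : ∀ z w, 1 ≤ θ z w) (hDr : ∀ z, ∑ w, D z w * θ z w ≤ dθ) (z : κ) : ∑ w, D z w ≤ dθ :=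
  (Finset.sum_le_sum fun w _ => le_mul_of_one_le_right (hD z w) (hθw1 z w)).trans (hDr z)

omit [Fintype ι] [DecidableEq ι] [DecidableEq κ] in
/-- `Σ_zD_{zw} ≤ dθ′` likewise. [folklore] -/
theorem plain_col_of_weighted (hD : ∀ x y, 0 ≤ D x y) (hθw1 : ∀ z w, 1 ≤ θ z w) (hDc : ∀ w, ∑ z, D z w * θ z w ≤ dθ') (w : κ) : ∑ z, D z w ≤ dθ' :=
  (Finset.sum_le_sum fun z _ => le_mul_of_one_le_right (hD z w) (hθw1 z w)).trans (hDc w)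

end Plain

section TheEnd

variable {U : EuclideanSpace ℝ ι → ℝ} {U' : EuclideanSpace ℝ ι → EuclideanSpace ℝ ι →L[ℝ] ℝ}
  {U'' : EuclideanSpace ℝ ι → EuclideanSpace ℝ ι →L[ℝ] EuclideanSpace ℝ ι →L[ℝ] ℝ}
  {U₃ : EuclideanSpace ℝ ι → EuclideanSpace ℝ ι →L[ℝ] EuclideanSpace ℝ ι →L[ℝ] EuclideanSpace ℝ ι →L[ℝ] ℝ} {Hk : ι → ι → ℝ} {K3 : ι → ι → ι → ℝ}
  {A : Matrix ι κ ℝ} {D : κ → κ → ℝ} {γop κ₀ κ₁ κ₂ κ₃ a τ δ θp lam lamA αr αc hr hc k3r k3c k3m γ dθ dθ' αθ βθ S : ℝ} {θ : κ → κ → ℝ}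
  {σ : ι → κ → ℝ} {ρ : ι → ι → ℝ}

/-- **THE OUTPUT IN THE INPUT'S ENTRY FORMAT**: `|T(ψ)[e_v,e_x,e_y]| ≤ K3⁺_{xyv} = M_{vxy}` for every background `ψ` ((479) with the slots
named as in the input letter `hK3`). [folklore] -/
theorem output_third_entry_format [Nonempty κ] (hΓop : (γop • (1 : Matrix ι ι ℝ) - A * Aᵀ).PosSemidef) (Y : Finset ι)
    (hUd : ∀ φ : EuclideanSpace ℝ ι, HasFDerivAt U (U' φ) φ) (hU'd : ∀ φ : EuclideanSpace ℝ ι, HasFDerivAt U' (U'' φ) φ)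
    (hU''d : ∀ φ : EuclideanSpace ℝ ι, HasFDerivAt U'' (U₃ φ) φ) (hU₃c : Continuous U₃) (hκ₀ : 0 ≤ κ₀) (hκ₁ : 0 ≤ κ₁) (ha : 0 ≤ a) (hκ₂ : 0 ≤ κ₂)
        (hκ₃ : 0 ≤ κ₃)
    (hτ : 0 < τ) (hδ : 0 < δ) (hθ0 : 0 < θp) (hθ1 : θp < 1) (hκθ : (2 * κ₀ * (1 + τ) + 4 * δ) * γop ≤ θp) (hκθw : 2 * κ₀ * (1 + τ) * γop + 4 * δ ≤ θp)
    (hstab : ∀ φ : EuclideanSpace ℝ ι, -(κ₀ * ∑ x ∈ Y, φ x ^ 2) ≤ U φ)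
    (hU'b : ∀ φ : EuclideanSpace ℝ ι, ‖U' φ‖ ≤ κ₁ * (a + ∑ x ∈ Y, φ x ^ 2)) (hU''b : ∀ φ : EuclideanSpace ℝ ι, ‖U'' φ‖ ≤ κ₂)
    (hU₃b : ∀ φ : EuclideanSpace ℝ ι, ‖U₃ φ‖ ≤ κ₃) (hlam : 0 ≤ lam)
    (hUsec : ∀ s : ℝ, 0 ≤ s → s ≤ 1 → ∀ a b : EuclideanSpace ℝ ι,
      U ((1 - s) • a + s • b) - lam / 2 * (s * (1 - s)) * ∑ i, (a i - b i) ^ 2 ≤ (1 - s) * U a + s * U b)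
    (hρg : lam * γop < 1)
    -- the majorants and their letters
    (hHk : ∀ (φ : EuclideanSpace ℝ ι) (x z : ι), |U'' φ (EuclideanSpace.single z (1 : ℝ)) (EuclideanSpace.single x (1 : ℝ))| ≤ Hk x z)
    (hHk0 : ∀ v u, 0 ≤ Hk v u)
    (hK3 : ∀ (φ : EuclideanSpace ℝ ι) (u x y : ι),
      |U₃ φ (EuclideanSpace.single u (1 : ℝ)) (EuclideanSpace.single x (1 : ℝ)) (EuclideanSpace.single y (1 : ℝ))| ≤ K3 x y u)
    (hhr : ∀ v, ∑ u, Hk v u ≤ hr)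
    -- the factor's letters and the smallness
    (ψ : EuclideanSpace ℝ ι) (hαr : ∀ u, ∑ w, |A u w| ≤ αr) (hαc : ∀ w, ∑ u, |A u w| ≤ αc)
    (hlamA : ∀ x : κ, ∑ u, ∑ v, |A u x| * |A v x| * Hk v u ≤ lamA) (hlamA1 : lamA < 1) (hγ : αc * hr * αr / (1 - lamA) ≤ γ) (hγ1 : γ < 1)
    -- the admissible `D` with weighted letters against `θ ≥ 1`, the weights, the weighted profiles, the site letter
    (hD : ∀ x y, 0 ≤ D x y)
    (hDC : ∀ x y, (if x = y then (1 : ℝ) else 0) + ∑ z, D x z * ((if y = z then 0 else ∑ u, ∑ v, |A u y| * |A v z| * Hk v u) / (1 - lamA)) ≤ D x y)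
    (hθw1 : ∀ z w, 1 ≤ θ z w) (hDr : ∀ z, ∑ w, D z w * θ z w ≤ dθ) (hdθ : 0 ≤ dθ) (hDc : ∀ w, ∑ z, D z w * θ z w ≤ dθ') (hdθ' : 0 ≤ dθ')
    (hσ0 : ∀ x w, 0 ≤ σ x w) (hσθ : ∀ x z w, σ x w ≤ σ x z * θ z w)
    (hρ1 : ∀ x y, 1 ≤ ρ x y) (hρsymm : ∀ x y, ρ x y = ρ y x) (hρmul : ∀ x y z, ρ x z ≤ ρ x y * ρ y z) (hρσ : ∀ x y w, ρ x y ^ 8 ≤ σ x w * σ y w)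
    (haσ : ∀ v : ι, ∑ w, (∑ u, |A u w| * Hk v u) * σ v w ≤ αθ) (hβ : 0 ≤ βθ) (haσ' : ∀ (v : ι) (w : κ), (∑ u, |A u w| * Hk v u) * σ v w ≤ βθ) (v x y
        : ι) :
    |(((∫ ω : EuclideanSpace ℝ ι, exp (-U (ω + ψ)) ∂(multivariateGaussian 0 (A * Aᵀ)))⁻¹ • (∫ ω : EuclideanSpace ℝ ι, (exp (-U (ω + ψ)) • (U₃ (ω + ψ)
        -
        (((ContinuousLinearMap.smulRightL ℝ (EuclideanSpace ℝ ι) (EuclideanSpace ℝ ι →L[ℝ] ℝ)) (U' (ω + ψ))).comp (U'' (ω + ψ)) +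
            (((ContinuousLinearMap.smulRightL ℝ
        (EuclideanSpace ℝ ι) (EuclideanSpace ℝ ι →L[ℝ] ℝ))).comp (U'' (ω + ψ))).flip (U' (ω + ψ)))) + (exp (-U (ω + ψ)) • -U' (ω + ψ)).smulRight (U''
            (ω + ψ) - (U' (ω +
        ψ)).smulRight (U' (ω + ψ)))) ∂(multivariateGaussian 0 (A * Aᵀ))) + ((-((∫ ω : EuclideanSpace ℝ ι, exp (-U (ω + ψ)) ∂(multivariateGaussian 0
            (A * Aᵀ))) ^ 2)⁻¹) • -(∫ ω :
        EuclideanSpace ℝ ι, exp (-U (ω + ψ)) • U' (ω + ψ) ∂(multivariateGaussian 0 (A * Aᵀ)))).smulRight (∫ ω : EuclideanSpace ℝ ι, exp (-U (ω + ψ))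
            • (U'' (ω + ψ) - (U' (ω +
        ψ)).smulRight (U' (ω + ψ))) ∂(multivariateGaussian 0 (A * Aᵀ)))) + (((ContinuousLinearMap.smulRightL ℝ (EuclideanSpace ℝ ι) (EuclideanSpace ℝ
            ι →L[ℝ] ℝ)) (((∫ ω :
        EuclideanSpace ℝ ι, exp (-U (ω + ψ)) ∂(multivariateGaussian 0 (A * Aᵀ))) ^ 2)⁻¹ • (∫ ω : EuclideanSpace ℝ ι, exp (-U (ω + ψ)) • U' (ω + ψ)
            ∂(multivariateGaussian 0
        (A * Aᵀ))))).comp (∫ ω : EuclideanSpace ℝ ι, exp (-U (ω + ψ)) • (U'' (ω + ψ) - (U' (ω + ψ)).smulRight (U' (ω + ψ))) ∂(multivariateGaussian 0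
            (A * Aᵀ))) +
        (((ContinuousLinearMap.smulRightL ℝ (EuclideanSpace ℝ ι) (EuclideanSpace ℝ ι →L[ℝ] ℝ))).comp (((∫ ω : EuclideanSpace ℝ ι, exp (-U (ω + ψ))
            ∂(multivariateGaussian 0
        (A * Aᵀ))) ^ 2)⁻¹ • (∫ ω : EuclideanSpace ℝ ι, exp (-U (ω + ψ)) • (U'' (ω + ψ) - (U' (ω + ψ)).smulRight (U' (ω + ψ))) ∂(multivariateGaussian
            0 (A * Aᵀ))) + ((-2 / (∫ ω :
        EuclideanSpace ℝ ι, exp (-U (ω + ψ)) ∂(multivariateGaussian 0 (A * Aᵀ))) ^ 3) • -(∫ ω : EuclideanSpace ℝ ι, exp (-U (ω + ψ)) • U' (ω + ψ)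
            ∂(multivariateGaussian 0
        (A * Aᵀ)))).smulRight (∫ ω : EuclideanSpace ℝ ι, exp (-U (ω + ψ)) • U' (ω + ψ) ∂(multivariateGaussian 0 (A * Aᵀ))))).flip (∫ ω :
            EuclideanSpace ℝ ι, exp (-U (ω + ψ)) • U' (ω
        + ψ) ∂(multivariateGaussian 0 (A * Aᵀ))))) (EuclideanSpace.single v (1 : ℝ)) (EuclideanSpace.single x (1 : ℝ)) (EuclideanSpace.single y (1 :
            ℝ))| ≤ (K3 x y v + ∑ w, (∑ z', D z' w * ∑ u, |A u z'| * K3 v y u) * (∑ z', D z' w * ∑ u, |A u z'| * Hk x u) / (1 - lamA) + ∑ w, (∑ z', D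
            z' w * ∑ u, |A u z'| * K3 v x u) * (∑ z', D z' w * ∑ u, |A u z'| * Hk y u) / (1 - lamA) + ∑ w, (∑ z', D z' w * ∑ u, |A u z'| * Hk v u) *
            (∑ z', D z' w * ∑ u, |A u z'| * K3 x y u) / (1 - lamA) + 4 * Real.sqrt (5 * (κ₂ ^ 4 * γop ^ 2) / (1 - lam * γop) ^ 2 * (αθ * dθ * (βθ *
            dθ') / (1 - lamA))) / (ρ v x * ρ v y)) := by
  have hθnn : ∀ z w, 0 ≤ θ z w := fun z w => zero_le_one.trans (hθw1 z w)
  exact whitened_third_kernel_entry hΓop Y hUd hU'd hU''d hU₃c hκ₀ hκ₁ ha hκ₂ hκ₃ hτ hδ hθ0 hθ1 hκθ hκθw hstab hU'b hU''b hU₃b hlam hUsec hρg hHk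
      hHk0 hK3 ψ hαr hαc hhr hlamA hlamA1 hγ hγ1 hD hDC hθnn hDr hdθ hDc hdθ' hσ0 hσθ hρ1 hρsymm hρmul hρσ haσ hβ haσ' v x y

/-- **THE OUTPUT ROW LETTER `κ₃r⁺`**: `Σ_yΣ_z|T(ψ)[e_x,e_y,e_z]| ≤ R₁` (entry ≤ `M`, then (482)'s slot-1 sum). [folklore] -/
theorem output_third_rowsum [Nonempty κ] (hΓop : (γop • (1 : Matrix ι ι ℝ) - A * Aᵀ).PosSemidef) (Y : Finset ι)
    (hUd : ∀ φ : EuclideanSpace ℝ ι, HasFDerivAt U (U' φ) φ) (hU'd : ∀ φ : EuclideanSpace ℝ ι, HasFDerivAt U' (U'' φ) φ)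
    (hU''d : ∀ φ : EuclideanSpace ℝ ι, HasFDerivAt U'' (U₃ φ) φ) (hU₃c : Continuous U₃) (hκ₀ : 0 ≤ κ₀) (hκ₁ : 0 ≤ κ₁) (ha : 0 ≤ a) (hκ₂ : 0 ≤ κ₂)
        (hκ₃ : 0 ≤ κ₃)
    (hτ : 0 < τ) (hδ : 0 < δ) (hθ0 : 0 < θp) (hθ1 : θp < 1) (hκθ : (2 * κ₀ * (1 + τ) + 4 * δ) * γop ≤ θp) (hκθw : 2 * κ₀ * (1 + τ) * γop + 4 * δ ≤ θp)
    (hstab : ∀ φ : EuclideanSpace ℝ ι, -(κ₀ * ∑ x ∈ Y, φ x ^ 2) ≤ U φ)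
    (hU'b : ∀ φ : EuclideanSpace ℝ ι, ‖U' φ‖ ≤ κ₁ * (a + ∑ x ∈ Y, φ x ^ 2)) (hU''b : ∀ φ : EuclideanSpace ℝ ι, ‖U'' φ‖ ≤ κ₂)
    (hU₃b : ∀ φ : EuclideanSpace ℝ ι, ‖U₃ φ‖ ≤ κ₃) (hlam : 0 ≤ lam)
    (hUsec : ∀ s : ℝ, 0 ≤ s → s ≤ 1 → ∀ a b : EuclideanSpace ℝ ι,
      U ((1 - s) • a + s • b) - lam / 2 * (s * (1 - s)) * ∑ i, (a i - b i) ^ 2 ≤ (1 - s) * U a + s * U b)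
    (hρg : lam * γop < 1)
    -- the majorants and their letters
    (hHk : ∀ (φ : EuclideanSpace ℝ ι) (x z : ι), |U'' φ (EuclideanSpace.single z (1 : ℝ)) (EuclideanSpace.single x (1 : ℝ))| ≤ Hk x z)
    (hHk0 : ∀ v u, 0 ≤ Hk v u)
    (hK3 : ∀ (φ : EuclideanSpace ℝ ι) (u x y : ι),
      |U₃ φ (EuclideanSpace.single u (1 : ℝ)) (EuclideanSpace.single x (1 : ℝ)) (EuclideanSpace.single y (1 : ℝ))| ≤ K3 x y u)
    (hhr : ∀ v, ∑ u, Hk v u ≤ hr)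
    -- the factor's letters and the smallness
    (ψ : EuclideanSpace ℝ ι) (hαr : ∀ u, ∑ w, |A u w| ≤ αr) (hαc : ∀ w, ∑ u, |A u w| ≤ αc)
    (hlamA : ∀ x : κ, ∑ u, ∑ v, |A u x| * |A v x| * Hk v u ≤ lamA) (hlamA1 : lamA < 1) (hγ : αc * hr * αr / (1 - lamA) ≤ γ) (hγ1 : γ < 1)
    -- the admissible `D` with weighted letters against `θ ≥ 1`, the weights, the weighted profiles, the site letter
    (hD : ∀ x y, 0 ≤ D x y)
    (hDC : ∀ x y, (if x = y then (1 : ℝ) else 0) + ∑ z, D x z * ((if y = z then 0 else ∑ u, ∑ v, |A u y| * |A v z| * Hk v u) / (1 - lamA)) ≤ D x y)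
    (hθw1 : ∀ z w, 1 ≤ θ z w) (hDr : ∀ z, ∑ w, D z w * θ z w ≤ dθ) (hdθ : 0 ≤ dθ) (hDc : ∀ w, ∑ z, D z w * θ z w ≤ dθ') (hdθ' : 0 ≤ dθ')
    (hσ0 : ∀ x w, 0 ≤ σ x w) (hσθ : ∀ x z w, σ x w ≤ σ x z * θ z w)
    (hρ1 : ∀ x y, 1 ≤ ρ x y) (hρsymm : ∀ x y, ρ x y = ρ y x) (hρmul : ∀ x y z, ρ x z ≤ ρ x y * ρ y z) (hρσ : ∀ x y w, ρ x y ^ 8 ≤ σ x w * σ y w)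
    (haσ : ∀ v : ι, ∑ w, (∑ u, |A u w| * Hk v u) * σ v w ≤ αθ) (hβ : 0 ≤ βθ) (haσ' : ∀ (v : ι) (w : κ), (∑ u, |A u w| * Hk v u) * σ v w ≤ βθ) (hK30 :
        ∀ x y u, 0 ≤ K3 x y u) (hhc : ∀ u, ∑ v, Hk v u ≤ hc)
    (hk3r : ∀ x, ∑ y, ∑ u, K3 x y u ≤ k3r) (hk3c : ∀ u, ∑ y, ∑ z, K3 y z u ≤ k3c) (hS : ∀ x, ∑ y, 1 / ρ x y ≤ S) (x : ι) :
    ∑ y, ∑ z, |(((∫ ω : EuclideanSpace ℝ ι, exp (-U (ω + ψ)) ∂(multivariateGaussian 0 (A * Aᵀ)))⁻¹ • (∫ ω : EuclideanSpace ℝ ι, (exp (-U (ω + ψ)) •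
        (U₃ (ω + ψ) -
        (((ContinuousLinearMap.smulRightL ℝ (EuclideanSpace ℝ ι) (EuclideanSpace ℝ ι →L[ℝ] ℝ)) (U' (ω + ψ))).comp (U'' (ω + ψ)) +
            (((ContinuousLinearMap.smulRightL ℝ
        (EuclideanSpace ℝ ι) (EuclideanSpace ℝ ι →L[ℝ] ℝ))).comp (U'' (ω + ψ))).flip (U' (ω + ψ)))) + (exp (-U (ω + ψ)) • -U' (ω + ψ)).smulRight (U''
            (ω + ψ) - (U' (ω +
        ψ)).smulRight (U' (ω + ψ)))) ∂(multivariateGaussian 0 (A * Aᵀ))) + ((-((∫ ω : EuclideanSpace ℝ ι, exp (-U (ω + ψ)) ∂(multivariateGaussian 0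
            (A * Aᵀ))) ^ 2)⁻¹) • -(∫ ω :
        EuclideanSpace ℝ ι, exp (-U (ω + ψ)) • U' (ω + ψ) ∂(multivariateGaussian 0 (A * Aᵀ)))).smulRight (∫ ω : EuclideanSpace ℝ ι, exp (-U (ω + ψ))
            • (U'' (ω + ψ) - (U' (ω +
        ψ)).smulRight (U' (ω + ψ))) ∂(multivariateGaussian 0 (A * Aᵀ)))) + (((ContinuousLinearMap.smulRightL ℝ (EuclideanSpace ℝ ι) (EuclideanSpace ℝ
            ι →L[ℝ] ℝ)) (((∫ ω :
        EuclideanSpace ℝ ι, exp (-U (ω + ψ)) ∂(multivariateGaussian 0 (A * Aᵀ))) ^ 2)⁻¹ • (∫ ω : EuclideanSpace ℝ ι, exp (-U (ω + ψ)) • U' (ω + ψ)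
            ∂(multivariateGaussian 0
        (A * Aᵀ))))).comp (∫ ω : EuclideanSpace ℝ ι, exp (-U (ω + ψ)) • (U'' (ω + ψ) - (U' (ω + ψ)).smulRight (U' (ω + ψ))) ∂(multivariateGaussian 0
            (A * Aᵀ))) +
        (((ContinuousLinearMap.smulRightL ℝ (EuclideanSpace ℝ ι) (EuclideanSpace ℝ ι →L[ℝ] ℝ))).comp (((∫ ω : EuclideanSpace ℝ ι, exp (-U (ω + ψ))
            ∂(multivariateGaussian 0
        (A * Aᵀ))) ^ 2)⁻¹ • (∫ ω : EuclideanSpace ℝ ι, exp (-U (ω + ψ)) • (U'' (ω + ψ) - (U' (ω + ψ)).smulRight (U' (ω + ψ))) ∂(multivariateGaussian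
            0 (A * Aᵀ))) + ((-2 / (∫ ω :
        EuclideanSpace ℝ ι, exp (-U (ω + ψ)) ∂(multivariateGaussian 0 (A * Aᵀ))) ^ 3) • -(∫ ω : EuclideanSpace ℝ ι, exp (-U (ω + ψ)) • U' (ω + ψ)
            ∂(multivariateGaussian 0
        (A * Aᵀ)))).smulRight (∫ ω : EuclideanSpace ℝ ι, exp (-U (ω + ψ)) • U' (ω + ψ) ∂(multivariateGaussian 0 (A * Aᵀ))))).flip (∫ ω :
            EuclideanSpace ℝ ι, exp (-U (ω + ψ)) • U' (ω
        + ψ) ∂(multivariateGaussian 0 (A * Aᵀ))))) (EuclideanSpace.single x (1 : ℝ)) (EuclideanSpace.single y (1 : ℝ)) (EuclideanSpace.single z (1 :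
            ℝ))| ≤
      k3c + (2 * (αr * k3r * (αc * hc)) + hr * αr * (αc * k3c)) * dθ * dθ' / (1 - lamA) + 4 * Real.sqrt (5 * (κ₂ ^ 4 * γop ^ 2) / (1 - lam * γop) ^ 2
          * (αθ * dθ * (βθ * dθ') / (1 - lamA))) * S ^ 2 := by
  have hθnn : ∀ z w, 0 ≤ θ z w := fun z w => zero_le_one.trans (hθw1 z w)
  have hDr' := plain_row_of_weighted hD hθw1 hDr
  have hDc' := plain_col_of_weighted hD hθw1 hDc
  have hCT : 0 ≤ 4 * Real.sqrt (5 * (κ₂ ^ 4 * γop ^ 2) / (1 - lam * γop) ^ 2 * (αθ * dθ * (βθ * dθ') / (1 - lamA))) := by positivity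
  refine le_trans (Finset.sum_le_sum fun y _ => Finset.sum_le_sum fun z _ =>
    whitened_third_kernel_entry hΓop Y hUd hU'd hU''d hU₃c hκ₀ hκ₁ ha hκ₂ hκ₃ hτ hδ hθ0 hθ1 hκθ hκθw hstab hU'b hU''b hU₃b hlam hUsec hρg hHk hHk0
        hK3 ψ hαr hαc hhr hlamA hlamA1 hγ hγ1 hD hDC hθnn hDr hdθ hDc hdθ' hσ0 hσθ hρ1 hρsymm hρmul hρσ haσ hβ haσ' x y z) ?_
  exact output_k3c hK30 hHk0 hαr hαc hhr hhc hk3r hk3c hlamA1 hD hDr' hDc' hCT hρ1 hS x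

/-! ## §2. THE END: the operator letter by Schur -/

/-- **THE OUTPUT OPERATOR LETTER `κ₃⁺`**: `‖T(ψ)‖ ≤ √(R₂R₃)` for every background `ψ`, `R₂, R₃` the slot-2∕slot-3 bounds of (482) — READ OFF
the kernel letters by (481), uniformly in the background and the volume. [folklore] -/
theorem output_third_opNorm [Nonempty κ] (hΓop : (γop • (1 : Matrix ι ι ℝ) - A * Aᵀ).PosSemidef) (Y : Finset ι)
    (hUd : ∀ φ : EuclideanSpace ℝ ι, HasFDerivAt U (U' φ) φ) (hU'd : ∀ φ : EuclideanSpace ℝ ι, HasFDerivAt U' (U'' φ) φ)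
    (hU''d : ∀ φ : EuclideanSpace ℝ ι, HasFDerivAt U'' (U₃ φ) φ) (hU₃c : Continuous U₃) (hκ₀ : 0 ≤ κ₀) (hκ₁ : 0 ≤ κ₁) (ha : 0 ≤ a) (hκ₂ : 0 ≤ κ₂)
        (hκ₃ : 0 ≤ κ₃)
    (hτ : 0 < τ) (hδ : 0 < δ) (hθ0 : 0 < θp) (hθ1 : θp < 1) (hκθ : (2 * κ₀ * (1 + τ) + 4 * δ) * γop ≤ θp) (hκθw : 2 * κ₀ * (1 + τ) * γop + 4 * δ ≤ θp)
    (hstab : ∀ φ : EuclideanSpace ℝ ι, -(κ₀ * ∑ x ∈ Y, φ x ^ 2) ≤ U φ)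
    (hU'b : ∀ φ : EuclideanSpace ℝ ι, ‖U' φ‖ ≤ κ₁ * (a + ∑ x ∈ Y, φ x ^ 2)) (hU''b : ∀ φ : EuclideanSpace ℝ ι, ‖U'' φ‖ ≤ κ₂)
    (hU₃b : ∀ φ : EuclideanSpace ℝ ι, ‖U₃ φ‖ ≤ κ₃) (hlam : 0 ≤ lam)
    (hUsec : ∀ s : ℝ, 0 ≤ s → s ≤ 1 → ∀ a b : EuclideanSpace ℝ ι,
      U ((1 - s) • a + s • b) - lam / 2 * (s * (1 - s)) * ∑ i, (a i - b i) ^ 2 ≤ (1 - s) * U a + s * U b)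
    (hρg : lam * γop < 1)
    -- the majorants and their letters
    (hHk : ∀ (φ : EuclideanSpace ℝ ι) (x z : ι), |U'' φ (EuclideanSpace.single z (1 : ℝ)) (EuclideanSpace.single x (1 : ℝ))| ≤ Hk x z)
    (hHk0 : ∀ v u, 0 ≤ Hk v u)
    (hK3 : ∀ (φ : EuclideanSpace ℝ ι) (u x y : ι),
      |U₃ φ (EuclideanSpace.single u (1 : ℝ)) (EuclideanSpace.single x (1 : ℝ)) (EuclideanSpace.single y (1 : ℝ))| ≤ K3 x y u)
    (hhr : ∀ v, ∑ u, Hk v u ≤ hr)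
    -- the factor's letters and the smallness
    (ψ : EuclideanSpace ℝ ι) (hαr : ∀ u, ∑ w, |A u w| ≤ αr) (hαc : ∀ w, ∑ u, |A u w| ≤ αc)
    (hlamA : ∀ x : κ, ∑ u, ∑ v, |A u x| * |A v x| * Hk v u ≤ lamA) (hlamA1 : lamA < 1) (hγ : αc * hr * αr / (1 - lamA) ≤ γ) (hγ1 : γ < 1)
    -- the admissible `D` with weighted letters against `θ ≥ 1`, the weights, the weighted profiles, the site letter
    (hD : ∀ x y, 0 ≤ D x y)
    (hDC : ∀ x y, (if x = y then (1 : ℝ) else 0) + ∑ z, D x z * ((if y = z then 0 else ∑ u, ∑ v, |A u y| * |A v z| * Hk v u) / (1 - lamA)) ≤ D x y)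
    (hθw1 : ∀ z w, 1 ≤ θ z w) (hDr : ∀ z, ∑ w, D z w * θ z w ≤ dθ) (hdθ : 0 ≤ dθ) (hDc : ∀ w, ∑ z, D z w * θ z w ≤ dθ') (hdθ' : 0 ≤ dθ')
    (hσ0 : ∀ x w, 0 ≤ σ x w) (hσθ : ∀ x z w, σ x w ≤ σ x z * θ z w)
    (hρ1 : ∀ x y, 1 ≤ ρ x y) (hρsymm : ∀ x y, ρ x y = ρ y x) (hρmul : ∀ x y z, ρ x z ≤ ρ x y * ρ y z) (hρσ : ∀ x y w, ρ x y ^ 8 ≤ σ x w * σ y w)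
    (haσ : ∀ v : ι, ∑ w, (∑ u, |A u w| * Hk v u) * σ v w ≤ αθ) (hβ : 0 ≤ βθ) (haσ' : ∀ (v : ι) (w : κ), (∑ u, |A u w| * Hk v u) * σ v w ≤ βθ) (hK30 :
        ∀ x y u, 0 ≤ K3 x y u) (hhc : ∀ u, ∑ v, Hk v u ≤ hc)
    (hk3r : ∀ x, ∑ y, ∑ u, K3 x y u ≤ k3r) (hk3c : ∀ u, ∑ y, ∑ z, K3 y z u ≤ k3c) (hk3m : ∀ y, ∑ x, ∑ u, K3 x y u ≤ k3m)
    (hS : ∀ x, ∑ y, 1 / ρ x y ≤ S) :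
    ‖(((∫ ω : EuclideanSpace ℝ ι, exp (-U (ω + ψ)) ∂(multivariateGaussian 0 (A * Aᵀ)))⁻¹ • (∫ ω : EuclideanSpace ℝ ι, (exp (-U (ω + ψ)) • (U₃ (ω + ψ)
        -
        (((ContinuousLinearMap.smulRightL ℝ (EuclideanSpace ℝ ι) (EuclideanSpace ℝ ι →L[ℝ] ℝ)) (U' (ω + ψ))).comp (U'' (ω + ψ)) +
            (((ContinuousLinearMap.smulRightL ℝ
        (EuclideanSpace ℝ ι) (EuclideanSpace ℝ ι →L[ℝ] ℝ))).comp (U'' (ω + ψ))).flip (U' (ω + ψ)))) + (exp (-U (ω + ψ)) • -U' (ω + ψ)).smulRight (U''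
            (ω + ψ) - (U' (ω +
        ψ)).smulRight (U' (ω + ψ)))) ∂(multivariateGaussian 0 (A * Aᵀ))) + ((-((∫ ω : EuclideanSpace ℝ ι, exp (-U (ω + ψ)) ∂(multivariateGaussian 0
            (A * Aᵀ))) ^ 2)⁻¹) • -(∫ ω :
        EuclideanSpace ℝ ι, exp (-U (ω + ψ)) • U' (ω + ψ) ∂(multivariateGaussian 0 (A * Aᵀ)))).smulRight (∫ ω : EuclideanSpace ℝ ι, exp (-U (ω + ψ))
            • (U'' (ω + ψ) - (U' (ω +
        ψ)).smulRight (U' (ω + ψ))) ∂(multivariateGaussian 0 (A * Aᵀ)))) + (((ContinuousLinearMap.smulRightL ℝ (EuclideanSpace ℝ ι) (EuclideanSpace ℝ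
            ι →L[ℝ] ℝ)) (((∫ ω :
        EuclideanSpace ℝ ι, exp (-U (ω + ψ)) ∂(multivariateGaussian 0 (A * Aᵀ))) ^ 2)⁻¹ • (∫ ω : EuclideanSpace ℝ ι, exp (-U (ω + ψ)) • U' (ω + ψ)
            ∂(multivariateGaussian 0
        (A * Aᵀ))))).comp (∫ ω : EuclideanSpace ℝ ι, exp (-U (ω + ψ)) • (U'' (ω + ψ) - (U' (ω + ψ)).smulRight (U' (ω + ψ))) ∂(multivariateGaussian 0
            (A * Aᵀ))) +
        (((ContinuousLinearMap.smulRightL ℝ (EuclideanSpace ℝ ι) (EuclideanSpace ℝ ι →L[ℝ] ℝ))).comp (((∫ ω : EuclideanSpace ℝ ι, exp (-U (ω + ψ))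
            ∂(multivariateGaussian 0
        (A * Aᵀ))) ^ 2)⁻¹ • (∫ ω : EuclideanSpace ℝ ι, exp (-U (ω + ψ)) • (U'' (ω + ψ) - (U' (ω + ψ)).smulRight (U' (ω + ψ))) ∂(multivariateGaussian
            0 (A * Aᵀ))) + ((-2 / (∫ ω :
        EuclideanSpace ℝ ι, exp (-U (ω + ψ)) ∂(multivariateGaussian 0 (A * Aᵀ))) ^ 3) • -(∫ ω : EuclideanSpace ℝ ι, exp (-U (ω + ψ)) • U' (ω + ψ)
            ∂(multivariateGaussian 0
        (A * Aᵀ)))).smulRight (∫ ω : EuclideanSpace ℝ ι, exp (-U (ω + ψ)) • U' (ω + ψ) ∂(multivariateGaussian 0 (A * Aᵀ))))).flip (∫ ω :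
            EuclideanSpace ℝ ι, exp (-U (ω + ψ)) • U' (ω
        + ψ) ∂(multivariateGaussian 0 (A * Aᵀ)))))‖ ≤
      Real.sqrt ((k3r + (hr * αr * (αc * k3c) + αr * k3m * (αc * hc) + αr * k3r * (αc * hc)) * dθ * dθ' / (1 - lamA) + 4 * Real.sqrt (5 * (κ₂ ^ 4 *
          γop ^ 2) / (1 - lam * γop) ^ 2 * (αθ * dθ * (βθ * dθ') / (1 - lamA))) * S ^ 2) *
        (k3m + (2 * (αr * k3m * (αc * hc)) + hr * αr * (αc * k3c)) * dθ * dθ' / (1 - lamA) + 4 * Real.sqrt (5 * (κ₂ ^ 4 * γop ^ 2) / (1 - lam * γop)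
            ^ 2 * (αθ * dθ * (βθ * dθ') / (1 - lamA))) * S ^ 2)) := by
  have hθnn : ∀ z w, 0 ≤ θ z w := fun z w => zero_le_one.trans (hθw1 z w)
  have hDr' := plain_row_of_weighted hD hθw1 hDr
  have hDc' := plain_col_of_weighted hD hθw1 hDc
  have hCT : 0 ≤ 4 * Real.sqrt (5 * (κ₂ ^ 4 * γop ^ 2) / (1 - lam * γop) ^ 2 * (αθ * dθ * (βθ * dθ') / (1 - lamA))) := by positivity
  refine opNorm_le_of_slot_letters _ (fun y => ?_) (fun z => ?_)
  · refine le_trans (Finset.sum_le_sum fun x _ => Finset.sum_le_sum fun z _ =>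
      whitened_third_kernel_entry hΓop Y hUd hU'd hU''d hU₃c hκ₀ hκ₁ ha hκ₂ hκ₃ hτ hδ hθ0 hθ1 hκθ hκθw hstab hU'b hU''b hU₃b hlam hUsec hρg hHk hHk0
          hK3 ψ hαr hαc hhr hlamA hlamA1 hγ hγ1 hD hDC hθnn hDr hdθ hDc hdθ' hσ0 hσθ hρ1 hρsymm hρmul hρσ haσ hβ haσ' x y z) ?_
    have h := output_k3r hK30 hHk0 hαr hαc hhr hhc hk3r hk3c hk3m hlamA1 hD hDr' hDc' hCT hρ1 hρsymm hS y
    rw [Finset.sum_comm] at h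
    exact h
  · refine le_trans (Finset.sum_le_sum fun x _ => Finset.sum_le_sum fun y _ =>
      whitened_third_kernel_entry hΓop Y hUd hU'd hU''d hU₃c hκ₀ hκ₁ ha hκ₂ hκ₃ hτ hδ hθ0 hθ1 hκθ hκθw hstab hU'b hU''b hU₃b hlam hUsec hρg hHk hHk0
          hK3 ψ hαr hαc hhr hlamA hlamA1 hγ hγ1 hD hDC hθnn hDr hdθ hDc hdθ' hσ0 hσθ hρ1 hρsymm hρmul hρσ haσ hβ haσ' x y z) ?_
    have h := output_k3m hK30 hHk0 hαr hαc hhr hhc hk3c hk3m hlamA1 hD hDr' hDc' hCT hρ1 hρsymm hS z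
    rw [Finset.sum_comm] at h
    exact h

end TheEnd

/-! ## §3. Toy -/

/-- Toy (§1's plain-from-weighted step in numbers): `1 ≤ 1·2`. -/
example : (1 : ℝ) ≤ 1 * 2 := by norm_num

end Summit.QuantumFields.BalabanUV.T4Continuum.NE7b.SupKernelClassThirdOrder

end
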